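import Summits.ValiantsHypothesis.ValiantsHypothesis.Theorems.AnyonJetsTwoAdicShadow
import Summits.ValiantsHypothesis.ValiantsHypothesis.Theorems.AnyonJetsConstantFreeJetGrowthDefs
import Literature.Computability.AlgebraicComplexity.PermanentBitsPPoly
import HarnessLib

/-!
# AnyonJets — crux `ConstantFreeJetGrowth` (stmt-ValiantsHypothesis-16738), line `birth`:
# stub `stub_twoAdicShadowCongruence` (the 2-adic shadow at 0/1 points)

Route `ValiantsHypothesis/AnyonJets`, crux `ConstantFreeJetGrowth`, registered line
`Cruxes/ConstantFreeJetGrowth/Lines/birth.lean` (objects `jet` / `shadow` / `zeroOne` in the companion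
`Theorems/AnyonJetsConstantFreeJetGrowthDefs.lean`, verbatim the line's §0). This file proves stub B
of the line, verbatim:

* `stub_twoAdicShadowCongruence` — at every 0/1 point `y`, the truncated resummation
  `F_(n,k) = Σ_(j<k) (−2)^j J_(n,j)` evaluates in `ZMod (2^k)` to the number of permutations supported
  on `y` (= `per(y) mod 2^k`).

Proof: a corollary of the sibling support item `TwoAdicShadow` (stmt-ValiantsHypothesis-16742, PROVED:
`twoAdicShadow_proof`, `per_n − F_(n,k) ∈ 2^k · ℤ[x]`; the line's `jet` is verbatim its `J`), of
`aeval_perPoly_bool` (`per_n(y) = #`supported permutations in any `ZMod p`) and of `2^k = 0` in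
`ZMod (2^k)` — the same three lines the tree's `AnyonJetsBooleanShadowToCF.lean` runs inline.

Honest framing: a «provable now» stub; the crux's content (`stub_perModPowBooleanHard`, an explicit
fixed-polynomial Boolean circuit lower bound) is untouched and the crux stays OPEN; VP ≠ VNP is NOT
proved here.
-/

noncomputable section

-- the summit and the problem share the name `ValiantsHypothesis` (D-0017 single-conjunct layout)
set_option linter.dupNamespace false

namespace Summit.ValiantsHypothesis.ValiantsHypothesis.Theorems.AnyonJets.ConstantFreeJetGrowth

open Literature.Computability.AlgebraicComplexity

/-- **Stub B — the 2-adic shadow at 0/1 points** (registered obligation `stub_twoAdicShadowCongruence`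
of crux `ConstantFreeJetGrowth`, line `birth`; signature verbatim): `F_(n,k)(y) = #{σ : ∀ j, y(σ j, j)}`
in `ZMod (2^k)` for every Boolean matrix `y`. [cite: Valiant1979, §1] -/
theorem stub_twoAdicShadowCongruence :
    ∀ (n k : ℕ) (y : Fin n × Fin n → Bool),
      MvPolynomial.aeval (zeroOne k y) (shadow n k) =
        ((Finset.univ.filter fun σ : Equiv.Perm (Fin n) => ∀ j, y (σ j, j) = true).card :
          ZMod (2 ^ k)) := by
  intro n k y
  obtain ⟨R, hR⟩ := twoAdicShadow_proof n k
  -- `shadow n k = per_n - 2^k • R`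
  have hS : shadow n k = perPoly (Fin n) ℤ - ((2 : ℤ) ^ k) • R := by
    have : perPoly (Fin n) ℤ - shadow n k = ((2 : ℤ) ^ k) • R := hR
    rw [← this]; ring
  have h2k : ((2 : ZMod (2 ^ k)) ^ k) = 0 := by
    have := ZMod.natCast_self (2 ^ k)
    push_cast at this
    exact this
  rw [hS, map_sub, MvPolynomial.smul_eq_C_mul, map_mul, MvPolynomial.aeval_C, map_pow, map_ofNat, h2k,
    zero_mul, sub_zero]
  exact aeval_perPoly_bool (2 ^ k) y


end Summit.ValiantsHypothesis.ValiantsHypothesis.Theorems.AnyonJets.ConstantFreeJetGrowth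

end
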